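import Literature.AlgebraicGeometry.Resolution.QuadraticTransformWeakTransform
import Literature.AlgebraicGeometry.Resolution.RegularLocalRingsQuotient
import HarnessLib

/-!
# [OURS · L1 W4.2] TAME-LOW row T-L4 «SNC PHASE, lineage-local» — part 1: the order of contact of a regular branch with another
# branch in a two-dimensional regular local ring (part 1a: the static calculus `contactOrder`, unit form, transversality)
# (cell res-hironaka, LADDER-RESOLUTION rung L; slot W4.2, crux chain w42 `SigmaMaxModificationsCorridor3` stmt-ResolutionOfSingularities-19249 /
# crux `SigmaMaxModifications` stmt-…-18506; res-L1-w42-plan-1 RULING v3.14-48 (PD)(iv)/(PF) row T-L4 → res-L1-w42-stub-4 (gen 7);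
# `--supports stmt-ResolutionOfSingularities-19249 --as helper`; consumers: res-D-pv-002 ((TL6) fuel, middle coordinate of `Sigma.TameLowFuel`),
# res-L1-type-o1 (`TameLowPrescription`), res-L1-s42-pv-2 (T-L5 board: the rays are the snc branches produced by this phase))

HONEST FRAMING.  OURS bookkeeping for the TAME-LOW tier of the tame split (RULING v3.14-48): classical commutative algebra of
two-dimensional regular local rings (Zariski; Abhyankar 1956; the Stacks Project §54.15), written in the currency of the
neighbouring rows T-L3 / T-L4(i) (`idealBaseTree`, `IsQuadraticTransform`: local rings of ONE field `K`, `QuadraticTransforms.lean`).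
Nothing here is a statement of H. Hironaka's manuscript [Hironaka2017] (CANDIDATE, never a premise) nor of Cossart–Jannsen–Saito;
no named fact is introduced or consumed; every declaration is PROVED. AI-written; weaker than expert review.

THE ROW (RULING -48 (PD)(iv)).  At a TAME-LOW point the dimension-two stage runs in the regular surface germ `H₂`; after the
base-point phase (T-L4(i), fuel = the tree theorem `finite_idealBaseTree_of_isRegularLocalRing`) the SNC PHASE blows up the
lineage point while the branch configuration (principal part of `Coeff(J)`, member traces, exceptional traces) is not snc
there. Its termination measure has a «singular-branch half» (the PROVED `δ`-drop `IsQuadraticTransform.curveDelta_lt`,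
`QuadraticTransformDelta.lean`) and a «tangency half» (Stacks 0BI7: a regular branch meets the exceptional curve transversally
in one point and its intersection multiplicity with any other branch drops). THIS FILE is the ring-level tangency half for a
pair of REGULAR branches, which is all the snc-defect measure of part 2 (`…SigmaTameLowSncStep`) consumes:

* §1 `contactOrder f g = sup {n | g ∈ (f) + 𝔪ⁿ} ∈ ℕ∞` in any local ring (for `f` a regular parameter of a two-dimensional
  regular local ring this is the intersection multiplicity `length R/(f, g)` = the valuation of `ḡ` in the DVR `R/(f)`; we
  never need that identification); `le_contactOrder_iff`, `contactOrder_eq_coe_iff`.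
* §2 for `𝔪 = (x, f)` with `f` prime, `f ∤ x`: `(f) + 𝔪ⁿ = (f) + (xⁿ)`; **`contactOrder f g = n ↔ g = a·f + u·xⁿ` with `u` a
  unit** (`exists_eq_add_mul_pow_of_contactOrder_eq`, `contactOrder_add_mul_pow`); `contactOrder f x = 1`.
* §3 in a two-dimensional regular local ring `R ⊆ K`: a pair `𝔪 = (x, f)` has `x, f` prime, `f ∤ x`, `x ∤ f`, `x, f ∉ 𝔪²`;
  for regular parameters `f, g`: `Ideal.span {f, g} = 𝔪 ↔ contactOrder f g = 1` (transversality), and a regular parameter `g`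
  with `(x, g) ≠ 𝔪` is `g = α x + q`, `α` a unit, `q ∈ 𝔪²` («`g` is tangent to `x`»).
* §4 (in part 1b `…SigmaTameLowSncTransform`): the behaviour of regular branches and of their contact orders under a
  quadratic transform (Stacks 0BI7 (2)(3) at ring level).

Part 1b (`…SigmaTameLowSncTransform`) does the transform; part 2 (`…SigmaTameLowSncStep`) assembles these into the snc-defect of a finite configuration of regular branches and its
strict lexicographic drop under a point blow-up at a non-snc lineage point; part 3 the lineage statement.

References: The Stacks Project, Tag 0BI7 (Lemma 54.15.3) [StacksProject]; O. Zariski, P. Samuel, *Commutative Algebra* II,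
App. 5 [ZariskiSamuel1960]; C. Huneke, I. Swanson (2006), §14.2 [HunekeSwanson2006]; S. D. Cutkosky 2014 §2.1 (quadratic
transforms) [Cutkosky2014].
-/

noncomputable section

set_option linter.dupNamespace false -- mandated namespace of this single-conjunct summit

open IsLocalRing Literature.AlgebraicGeometry.Resolution

namespace Summit.ResolutionOfSingularities.ResolutionOfSingularities.Theorems.SigmaMaxModificationsCorridor3.TameLowSnc

universe u

/-! ## §1 The order of contact `sup {n | g ∈ (f) + 𝔪ⁿ}` in a local ring -/

section Contact

variable {A : Type u} [CommRing A] [IsLocalRing A]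

omit [IsLocalRing A] in
/-- `(a, b) ⊆ I ↔ a ∈ I ∧ b ∈ I`. [folklore] -/
theorem span_pair_le_iff {a b : A} {I : Ideal A} : Ideal.span {a, b} ≤ I ↔ a ∈ I ∧ b ∈ I := by
  rw [Ideal.span_le, Set.insert_subset_iff, Set.singleton_subset_iff]; rfl

/-- **Order of contact of `g` with `f`** in a local ring `(A, 𝔪)`: `sup {n | g ∈ (f) + 𝔪ⁿ} ∈ ℕ∞`. For `f` a regular parameter
of a two-dimensional regular local ring, `A/(f)` is a discrete valuation ring and this is the valuation of the residue of `g`,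
i.e. the intersection multiplicity `length A/(f, g)` of the branches `V(f)`, `V(g)` ((54.15.2.1) of the Stacks Project, Tag 0BI6);
`⊤` iff `g ∈ ⋂ₙ ((f) + 𝔪ⁿ)`. [OURS · L1 W4.2 bookkeeping; classical] -/
def contactOrder (f g : A) : ℕ∞ :=
  ⨆ n : {n : ℕ // g ∈ Ideal.span {f} ⊔ maximalIdeal A ^ n}, (n.1 : ℕ∞)

/-- `n ≤ contactOrder f g ↔ g ∈ (f) + 𝔪ⁿ` (the family `(f) + 𝔪ⁿ` is decreasing in `n`). [OURS · proved] -/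
theorem le_contactOrder_iff (f g : A) (n : ℕ) :
    (n : ℕ∞) ≤ contactOrder f g ↔ g ∈ Ideal.span {f} ⊔ maximalIdeal A ^ n := by
  constructor
  · intro h
    by_contra hn
    have hlt : ∀ i : {i : ℕ // g ∈ Ideal.span {f} ⊔ maximalIdeal A ^ i}, i.1 < n := by
      intro i
      by_contra hi
      have hle : Ideal.span {f} ⊔ maximalIdeal A ^ i.1 ≤ Ideal.span {f} ⊔ maximalIdeal A ^ n :=
        sup_le_sup_left (Ideal.pow_le_pow_right (not_lt.mp hi)) _
      exact hn (hle i.2)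
    have hn0 : n ≠ 0 := by
      rintro rfl
      exact hn (by rw [pow_zero, Ideal.one_eq_top, sup_top_eq]; exact Submodule.mem_top)
    have : contactOrder f g ≤ ((n - 1 : ℕ) : ℕ∞) :=
      iSup_le fun i => by exact_mod_cast Nat.le_sub_one_of_lt (hlt i)
    have h' : n ≤ n - 1 := by exact_mod_cast h.trans this
    omega
  · intro h
    exact le_iSup (fun i : {i : ℕ // g ∈ Ideal.span {f} ⊔ maximalIdeal A ^ i} => (i.1 : ℕ∞)) ⟨n, h⟩

/-- `contactOrder f g = n ↔ g ∈ (f) + 𝔪ⁿ` and `g ∉ (f) + 𝔪ⁿ⁺¹`. [OURS · proved] -/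
theorem contactOrder_eq_coe_iff (f g : A) (n : ℕ) :
    contactOrder f g = n ↔
      g ∈ Ideal.span {f} ⊔ maximalIdeal A ^ n ∧ g ∉ Ideal.span {f} ⊔ maximalIdeal A ^ (n + 1) := by
  rw [← le_contactOrder_iff, ← le_contactOrder_iff]
  constructor
  · intro h
    rw [h]
    exact ⟨le_rfl, by exact_mod_cast Nat.lt_irrefl n⟩
  · rintro ⟨h1, h2⟩
    rcases eq_or_ne (contactOrder f g) ⊤ with htop | hne
    · exact absurd (htop ▸ le_top) h2
    · obtain ⟨m, hm⟩ := ENat.ne_top_iff_exists.mp hne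
      rw [← hm] at h1 h2 ⊢
      have h1' : n ≤ m := by exact_mod_cast h1
      have h2' : ¬ n + 1 ≤ m := by exact_mod_cast h2
      exact_mod_cast (by omega : m = n)

/-- `contactOrder f g = ⊤ ↔ g ∈ (f) + 𝔪ⁿ` for every `n`. [OURS · proved] -/
theorem contactOrder_eq_top_iff (f g : A) :
    contactOrder f g = ⊤ ↔ ∀ n : ℕ, g ∈ Ideal.span {f} ⊔ maximalIdeal A ^ n := by
  constructor
  · intro h n
    exact (le_contactOrder_iff f g n).mp (h ▸ le_top)
  · intro h
    refine ENat.eq_top_iff_forall_ge.mpr fun n => (le_contactOrder_iff f g n).mpr (h n)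

/-- `1 ≤ contactOrder f g` for `g ∈ 𝔪`. [OURS · proved] -/
theorem one_le_contactOrder_of_mem {f g : A} (hg : g ∈ maximalIdeal A) : (1 : ℕ∞) ≤ contactOrder f g := by
  have := (le_contactOrder_iff f g 1).mpr (by rw [pow_one]; exact Ideal.mem_sup_right hg)
  exact_mod_cast this

/-- `contactOrder f g = 0` for `g ∉ 𝔪` (and `f ∈ 𝔪`). [OURS · proved] -/
theorem contactOrder_eq_zero_of_not_mem {f g : A} (hf : f ∈ maximalIdeal A) (hg : g ∉ maximalIdeal A) :
    contactOrder f g = 0 := by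
  have h := (contactOrder_eq_coe_iff f g 0).mpr
  simp only [CharP.cast_eq_zero, pow_zero, Ideal.one_eq_top, zero_add, pow_one] at h
  refine h ⟨by rw [sup_top_eq]; exact Submodule.mem_top, fun hmem => hg ?_⟩
  have hle : Ideal.span {f} ⊔ maximalIdeal A ≤ maximalIdeal A :=
    sup_le ((Ideal.span_singleton_le_iff_mem _).mpr hf) le_rfl
  exact hle hmem

end Contact

/-! ## §2 Contact with a regular parameter: `(f) + 𝔪ⁿ = (f) + (xⁿ)` and the unit form `g = a f + u xⁿ` -/

section Pair

variable {A : Type u} [CommRing A] [IsLocalRing A] {x f : A}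

/-- For `𝔪 = (x, f)`: `𝔪ⁿ ⊆ (f) + (xⁿ)`. [OURS · proved] -/
theorem pow_maximalIdeal_le_sup_span_pow (hm : maximalIdeal A = Ideal.span {x, f}) (n : ℕ) :
    maximalIdeal A ^ n ≤ Ideal.span {f} ⊔ Ideal.span {x ^ n} := by
  induction n with
  | zero => rw [pow_zero, pow_zero, Ideal.span_singleton_one, sup_top_eq]; exact le_top
  | succ n ih =>
    rw [pow_succ]
    refine (Ideal.mul_mono_left ih).trans ?_
    rw [Ideal.sup_mul, hm]
    refine sup_le (Ideal.mul_le_right.trans le_sup_left) ?_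
    rw [Ideal.mul_le]
    intro a ha b hb
    obtain ⟨c, rfl⟩ := Ideal.mem_span_singleton'.mp ha
    obtain ⟨α, β, rfl⟩ := Ideal.mem_span_pair.mp hb
    have e : c * x ^ n * (α * x + β * f) = (c * x ^ n * β) * f + (c * α) * x ^ (n + 1) := by ring
    rw [e]
    exact Ideal.add_mem _ (Ideal.mem_sup_left (Ideal.mem_span_singleton'.mpr ⟨_, rfl⟩))
      (Ideal.mem_sup_right (Ideal.mem_span_singleton'.mpr ⟨_, rfl⟩))

/-- For `𝔪 = (x, f)`: `g ∈ (f) + 𝔪ⁿ ↔ g = a f + b xⁿ` for some `a, b`. [OURS · proved] -/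
theorem mem_sup_pow_iff (hm : maximalIdeal A = Ideal.span {x, f}) (g : A) (n : ℕ) :
    g ∈ Ideal.span {f} ⊔ maximalIdeal A ^ n ↔ ∃ a b : A, g = a * f + b * x ^ n := by
  constructor
  · intro hg
    have hg' : g ∈ Ideal.span {f} ⊔ Ideal.span {x ^ n} :=
      (sup_le le_sup_left (pow_maximalIdeal_le_sup_span_pow hm n)) hg
    obtain ⟨p, hp, q, hq, rfl⟩ := Submodule.mem_sup.mp hg'
    obtain ⟨a, rfl⟩ := Ideal.mem_span_singleton'.mp hp
    obtain ⟨b, rfl⟩ := Ideal.mem_span_singleton'.mp hq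
    exact ⟨a, b, rfl⟩
  · rintro ⟨a, b, rfl⟩
    have hx : x ∈ maximalIdeal A := hm ▸ Ideal.subset_span (by simp)
    exact Ideal.add_mem _ (Ideal.mem_sup_left (Ideal.mem_span_singleton'.mpr ⟨a, rfl⟩))
      (Ideal.mem_sup_right (Ideal.mul_mem_left _ _ (Ideal.pow_mem_pow hx n)))

/-- **Unit form of finite contact**: for `𝔪 = (x, f)`, if `g ∈ (f) + 𝔪ⁿ` and `g ∉ (f) + 𝔪ⁿ⁺¹` then `g = a f + u xⁿ` with `u` a
unit. [OURS · proved] -/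
theorem exists_eq_add_mul_pow_of_mem_of_not_mem (hm : maximalIdeal A = Ideal.span {x, f}) {g : A} {n : ℕ}
    (h1 : g ∈ Ideal.span {f} ⊔ maximalIdeal A ^ n) (h2 : g ∉ Ideal.span {f} ⊔ maximalIdeal A ^ (n + 1)) :
    ∃ a u : A, IsUnit u ∧ g = a * f + u * x ^ n := by
  obtain ⟨a, b, rfl⟩ := (mem_sup_pow_iff hm g n).mp h1
  refine ⟨a, b, ?_, rfl⟩
  by_contra hb
  apply h2
  have hb' : b ∈ maximalIdeal A := (mem_maximalIdeal _).mpr hb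
  rw [hm, Ideal.mem_span_pair] at hb'
  obtain ⟨c, d, rfl⟩ := hb'
  refine (mem_sup_pow_iff hm _ (n + 1)).mpr ⟨a + d * x ^ n, c, ?_⟩
  ring

/-- **The unit form has contact exactly `n`**: for `𝔪 = (x, f)` with `f` prime and `f ∤ x`, `contactOrder f (a f + u xⁿ) = n` for a
unit `u` (if also `= a' f + b xⁿ⁺¹` then `f ∣ xⁿ (u − b x)` with `u − b x` a unit). [OURS · proved] -/
theorem contactOrder_add_mul_pow (hm : maximalIdeal A = Ideal.span {x, f}) (hfp : Prime f) (hfx : ¬ f ∣ x)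
    (a : A) {u : A} (hu : IsUnit u) (n : ℕ) : contactOrder f (a * f + u * x ^ n) = n := by
  have hx : x ∈ maximalIdeal A := hm ▸ Ideal.subset_span (by simp)
  have hf : f ∈ maximalIdeal A := hm ▸ Ideal.subset_span (by simp)
  refine (contactOrder_eq_coe_iff _ _ n).mpr ⟨(mem_sup_pow_iff hm _ n).mpr ⟨a, u, rfl⟩, fun hmem => ?_⟩
  obtain ⟨a', b, hab⟩ := (mem_sup_pow_iff hm _ (n + 1)).mp hmem
  -- `xⁿ (u - b x) = (a' - a) f`
  have hdvd : f ∣ x ^ n * (u - b * x) := ⟨a' - a, by linear_combination hab⟩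
  rcases hfp.dvd_or_dvd hdvd with h | h
  · exact hfx (hfp.dvd_of_dvd_pow h)
  · -- `u - b x` is a unit, so `f` would be a unit
    have hunit : IsUnit (u - b * x) := by
      by_contra hnu
      have h1 : u - b * x ∈ maximalIdeal A := (mem_maximalIdeal _).mpr hnu
      have h2 : u ∈ maximalIdeal A := by
        have := Ideal.add_mem _ h1 (Ideal.mul_mem_left _ b hx)
        rwa [sub_add_cancel] at this
      exact (mem_maximalIdeal _).mp h2 hu
    exact (mem_maximalIdeal _).mp hf (isUnit_of_dvd_unit h hunit)

/-- For `𝔪 = (x, f)` with `f` prime, `f ∤ x`: **`contactOrder f g = n ↔ g = a f + u xⁿ` for some `a` and unit `u`**. [OURS · proved] -/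
theorem contactOrder_eq_coe_iff_exists (hm : maximalIdeal A = Ideal.span {x, f}) (hfp : Prime f) (hfx : ¬ f ∣ x)
    (g : A) (n : ℕ) : contactOrder f g = n ↔ ∃ a u : A, IsUnit u ∧ g = a * f + u * x ^ n := by
  constructor
  · intro h
    obtain ⟨h1, h2⟩ := (contactOrder_eq_coe_iff f g n).mp h
    exact exists_eq_add_mul_pow_of_mem_of_not_mem hm h1 h2
  · rintro ⟨a, u, hu, rfl⟩
    exact contactOrder_add_mul_pow hm hfp hfx a hu n

/-- For `𝔪 = (x, f)` with `f` prime, `f ∤ x`: the exceptional parameter is transversal to `f`, `contactOrder f x = 1`.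
[OURS · proved] -/
theorem contactOrder_self_right_eq_one (hm : maximalIdeal A = Ideal.span {x, f}) (hfp : Prime f) (hfx : ¬ f ∣ x) :
    contactOrder f x = 1 := by
  have h := contactOrder_add_mul_pow hm hfp hfx 0 isUnit_one 1
  simpa using h

end Pair

/-! ## §3 Regular parameters of a two-dimensional regular local ring of `K` -/

section Regular

variable {K : Type u} [Field K] {R : Subring K} [IsRegularLocalRing R]

/-- In a two-dimensional regular local ring, a pair `𝔪 = (x, f)` consists of prime elements outside `𝔪²` with `f ∤ x`.
[OURS · proved; Matsumura Thm. 14.2/14.3] -/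
theorem prime_and_not_dvd_of_span_pair (hdim : ringKrullDim R = 2) {x f : R} (hm : maximalIdeal R = Ideal.span {x, f}) :
    Prime f ∧ ¬ f ∣ x ∧ f ∉ maximalIdeal R ^ 2 ∧ x ∉ maximalIdeal R ^ 2 := by
  have hm' : maximalIdeal R = Ideal.span {f, x} := by rw [hm, Ideal.span_pair_comm]
  have hx2 : x ∉ maximalIdeal R ^ 2 := fst_not_mem_sq hdim hm
  have hf2 : f ∉ maximalIdeal R ^ 2 := fst_not_mem_sq hdim hm'
  have hf : f ∈ maximalIdeal R := hm ▸ Ideal.subset_span (by simp)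
  have hfp : Prime f := IsRegularLocalRing.prime_of_not_mem_sq hf hf2
  refine ⟨hfp, fun hfx => ?_, hf2, hx2⟩
  apply maximalIdeal_ne_span_singleton hdim f
  rw [hm]
  apply le_antisymm
  · exact span_pair_le_iff.mpr ⟨Ideal.mem_span_singleton.mpr hfx, Ideal.mem_span_singleton_self _⟩
  · exact Ideal.span_mono (by simp)

/-- A regular parameter (`g ∈ 𝔪 ∖ 𝔪²`) of a two-dimensional regular local ring with `(x, g) ≠ 𝔪`, where `𝔪 = (x, y)`, is
**tangent to `x`**: `g = α x + q` with `α` a unit and `q ∈ 𝔪²`. [OURS · proved] -/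
theorem exists_eq_unit_mul_add_of_span_pair_ne {x y g : R} (hm : maximalIdeal R = Ideal.span {x, y})
    (hg : g ∈ maximalIdeal R) (hg2 : g ∉ maximalIdeal R ^ 2) (hne : Ideal.span {x, g} ≠ maximalIdeal R) :
    ∃ α q : R, IsUnit α ∧ q ∈ maximalIdeal R ^ 2 ∧ g = α * x + q := by
  have hx : x ∈ maximalIdeal R := hm ▸ Ideal.subset_span (by simp)
  have hy : y ∈ maximalIdeal R := hm ▸ Ideal.subset_span (by simp)
  have hg' := hg
  rw [hm, Ideal.mem_span_pair] at hg'
  obtain ⟨α, β, rfl⟩ := hg'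
  -- `β` is not a unit, else `y ∈ (x, g)` and `(x, g) = 𝔪`
  have hβ : ¬ IsUnit β := by
    intro hβ
    apply hne
    apply le_antisymm
    · exact span_pair_le_iff.mpr ⟨hx, hg⟩
    · rw [hm]
      refine span_pair_le_iff.mpr ⟨Ideal.subset_span (by simp), ?_⟩
      obtain ⟨v, hv⟩ := hβ
      have e : ((v⁻¹ : Rˣ) : R) * ((α * x + β * y) - α * x) = y := by
        rw [← hv]; linear_combination y * Units.inv_mul v
      have hmem : ((v⁻¹ : Rˣ) : R) * ((α * x + β * y) - α * x) ∈ Ideal.span {x, α * x + β * y} :=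
        Ideal.mul_mem_left _ _ (Ideal.sub_mem _ (Ideal.subset_span (by simp))
          (Ideal.mul_mem_left _ _ (Ideal.subset_span (by simp))))
      rwa [e] at hmem
  have hβm : β ∈ maximalIdeal R := (mem_maximalIdeal _).mpr hβ
  have hq : β * y ∈ maximalIdeal R ^ 2 := by rw [pow_two]; exact Ideal.mul_mem_mul hβm hy
  refine ⟨α, β * y, ?_, hq, rfl⟩
  by_contra hα
  exact hg2 (by
    rw [pow_two]
    exact Ideal.add_mem _ (Ideal.mul_mem_mul ((mem_maximalIdeal _).mpr hα) hx) (pow_two (maximalIdeal R) ▸ hq))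

/-- **Transversality of two regular parameters is contact one**: in a two-dimensional regular local ring, for `f ∈ 𝔪 ∖ 𝔪²` and
`g ∈ 𝔪`: `Ideal.span {f, g} = 𝔪 ↔ contactOrder f g = 1`. [OURS · proved] -/
theorem span_pair_eq_maximalIdeal_iff_contactOrder_eq_one (hdim : ringKrullDim R = 2) {f g : R}
    (hf : f ∈ maximalIdeal R) (hf2 : f ∉ maximalIdeal R ^ 2) (hg : g ∈ maximalIdeal R) :
    Ideal.span {f, g} = maximalIdeal R ↔ contactOrder f g = 1 := by
  -- complete `f` to a pair `𝔪 = (f, y)`, i.e. `𝔪 = (y, f)`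
  obtain ⟨y, hmy, -, -⟩ := exists_maximalIdeal_eq_span_pair_of_not_mem_sq hdim hf hf2
  have hm : maximalIdeal R = Ideal.span {y, f} := by rw [hmy, Ideal.span_pair_comm]
  obtain ⟨hfp, hfy, -, -⟩ := prime_and_not_dvd_of_span_pair hdim hm
  rw [← Nat.cast_one, contactOrder_eq_coe_iff_exists hm hfp hfy]
  constructor
  · intro hspan
    -- `y = a f + b g`, and `g = c y + d f`; then `g = (…) f + (b⁻¹-ish) y`: directly, `g ∈ (f) + 𝔪¹` always; show unit form
    have hg1 : g ∈ Ideal.span {f} ⊔ maximalIdeal R ^ 1 := by rw [pow_one]; exact Ideal.mem_sup_right hg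
    refine exists_eq_add_mul_pow_of_mem_of_not_mem hm hg1 fun hg2 => ?_
    -- if `g ∈ (f) + 𝔪²` then `𝔪 = (f, g) ⊆ (f) + 𝔪²`, so `y ∈ (f) + 𝔪²`: `y = a f + u y^… `; use the unit form for `y`
    have hy1 : contactOrder f y = 1 := contactOrder_self_right_eq_one hm hfp hfy
    have hle : maximalIdeal R ≤ Ideal.span {f} ⊔ maximalIdeal R ^ 2 := by
      have h := span_pair_le_iff.mpr ⟨Ideal.mem_sup_left (Ideal.mem_span_singleton_self f), hg2⟩
      rwa [hspan] at h
    have hy : y ∈ maximalIdeal R := hm ▸ Ideal.subset_span (by simp)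
    exact ((contactOrder_eq_coe_iff f y 1).mp hy1).2 (hle hy)
  · rintro ⟨a, u, hu, hg'⟩
    apply le_antisymm
    · exact span_pair_le_iff.mpr ⟨hf, hg⟩
    · rw [hm]
      refine span_pair_le_iff.mpr ⟨?_, Ideal.subset_span (by simp)⟩
      -- `y = u⁻¹ (g - a f)`
      obtain ⟨v, hv⟩ := hu
      have e : ((v⁻¹ : Rˣ) : R) * (g - a * f) = y := by
        rw [hg', ← hv]; linear_combination y * Units.inv_mul v
      have hmem : ((v⁻¹ : Rˣ) : R) * (g - a * f) ∈ Ideal.span {f, g} :=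
        Ideal.mul_mem_left _ _ (Ideal.sub_mem _ (Ideal.subset_span (by simp))
          (Ideal.mul_mem_left _ _ (Ideal.subset_span (by simp))))
      rwa [e] at hmem

end Regular


end Summit.ResolutionOfSingularities.ResolutionOfSingularities.Theorems.SigmaMaxModificationsCorridor3.TameLowSnc

end
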